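import Summits.KontsevichZagierPeriods.KontsevichZagierPeriods.Theorems.RootDecompWalshStrataSectorWalls01

/-!
# Root decomposition & Walsh strata — E-type sectors with line walls, part 2 (gen 8, §34.4–34.6; v3)

The sector theorem `InBaker.of_psector_walls` (an E-type sector piece whose walls off the axis are the conic
and finitely many rational lines — no condition on the lines off the centre, every stratum of the line
terminal being covered by part 1 and §35) and the re-derivation of the specimen's sector lemma
(`inBaker_specA'`).  See part 1 for the overview of §34. [KontsevichZagier2001 §1.2; BCR1998 §2.2; this node]
-/

noncomputable section

open Set MeasureTheory MvPolynomial Literature.NumberTheory.Transcendental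
open Literature.ModelTheory.ExponentialFields (IsSemialgebraic isSemialgebraic_univ isSemialgebraic_setOf_eval_pos
  isSemialgebraic_setOf_eval_eq_zero isSemialgebraic_setOf_eval_lt)

namespace Summit.KontsevichZagierPeriods.RootDecompWalshStrata.ConicDescent.BallCube

variable {κ₀ κ₁ : ℚ}

/-! (private copy of `snoc2_zero'` — its public twin in this chain was privatised under the dedup.landed policy) -/
/-- `(x, t)₀ = x₀` on `Fin 2` (rfl helper; the twins in other parts are private). [folklore] -/
@[simp] private theorem snoc2_zero' (x : Fin 1 → ℝ) (t : ℝ) : (Fin.snoc x t : Fin 2 → ℝ) 0 = x 0 := rfl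

/-! (private copy of `snoc2_one'` — its public twin in this chain was privatised under the dedup.landed policy) -/
/-- `(x, t)₁ = t` on `Fin 2` (rfl helper). [folklore] -/
@[simp] private theorem snoc2_one' (x : Fin 1 → ℝ) (t : ℝ) : (Fin.snoc x t : Fin 2 → ℝ) 1 = t := rfl

/-! #### 34.4 What a boundary section of a sector piece looks like -/

/-- **FRONTIER FACTS.**  For an open target `T` inside a closed set `C` lying in the closed normalised
sector `{0 ≤ Y ≤ X, κ₀X² + κ₁Y² ≤ 1}`, a frontier point `(t, z)` of the chart domain has `z ≥ 0`, and if
`z > 0` then `t ∈ [0, 1]`, `z ≤ 1` and the chart point `w = Φ(t, z)` lies in `C ∖ T` with `X > 0`, `Y = Xt`,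
`κ₀X² + κ₁Y² = z²`, `X·N(t) = z`. [this node] -/
theorem psector_frontier_facts (hκ : 0 < κ₀ ∧ 0 ≤ κ₁) {T C : Set (Fin 2 → ℝ)} (hT : IsOpen T)
    (hC : IsClosed C) (hTC : T ⊆ C)
    (hCsec : ∀ w ∈ C, 0 ≤ w 1 ∧ w 1 ≤ w 0 ∧ (κ₀ : ℝ) * w 0 ^ 2 + κ₁ * w 1 ^ 2 ≤ 1)
    {x : Fin 1 → ℝ} {z : ℝ} (hp : Fin.snoc x z ∈ frontier (pchartDom κ₀ κ₁ T)) :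
    0 ≤ z ∧ (0 < z → (0 ≤ x 0 ∧ x 0 ≤ 1) ∧ z ^ 2 ≤ 1 ∧
      ∃ w ∈ C, w ∉ T ∧ 0 < w 0 ∧ w 1 = w 0 * x 0 ∧
        (κ₀ : ℝ) * w 0 ^ 2 + κ₁ * w 1 ^ 2 = z ^ 2 ∧ w 0 * pN κ₀ κ₁ (x 0) = z) := by
  obtain ⟨h0, hwC, hnT⟩ := frontier_pchartDom_subset hκ hT hC hTC hp
  simp only [snoc2_one'] at h0 hnT
  refine ⟨h0, fun hz => ?_⟩
  have hsq := pΦ_sq_add hκ (Fin.snoc x z : Fin 2 → ℝ)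
  have hYX := pΦ_one_eq (κ₀ := κ₀) (κ₁ := κ₁) (Fin.snoc x z : Fin 2 → ℝ)
  have hXp : 0 < pΦ κ₀ κ₁ (Fin.snoc x z : Fin 2 → ℝ) 0 := pΦ_zero_pos hκ (by simpa using hz)
  have hXN : pΦ κ₀ κ₁ (Fin.snoc x z : Fin 2 → ℝ) 0 * pN κ₀ κ₁ (x 0) = z := by
    rw [pΦ_zero, snoc2_zero', snoc2_one', pI, mul_assoc, inv_mul_cancel₀ (pN_pos hκ (x 0)).ne',
      mul_one]
  obtain ⟨hY0, hYX', hR⟩ := hCsec _ hwC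
  set X := pΦ κ₀ κ₁ (Fin.snoc x z : Fin 2 → ℝ) 0 with hXdef
  set Y := pΦ κ₀ κ₁ (Fin.snoc x z : Fin 2 → ℝ) 1 with hYdef
  simp only [snoc2_zero', snoc2_one'] at hsq hYX
  have ht0 : 0 ≤ x 0 := by
    have h := hY0
    rw [hYX] at h
    exact (mul_nonneg_iff_of_pos_left hXp).1 h
  have ht1 : x 0 ≤ 1 := by
    have h := hYX'
    rw [hYX] at h
    exact (mul_le_iff_le_one_right hXp).1 h
  have hz1 : z ^ 2 ≤ 1 := by rw [← hsq]; exact hR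
  exact ⟨⟨ht0, ht1⟩, hz1, _, hwC, hnT hz, hXp, hYX, hsq, hXN⟩

/-! #### 34.5 The sector theorem -/

/-- **E-TYPE SECTOR PIECE WITH LINE WALLS.**  `[T, γ√(a(κ₀X² + κ₁Y²) + c)] ∈ InBaker` for an open piece
`T` of the normalised sector whose boundary (inside a closed `C` within the closed sector) off the axis
`X = 0` lies on the conic `a(κ₀X² + κ₁Y²) + c = 0` and on finitely many rational lines `ℓ i`, the lines
through the centre being genuine (`(k₁, k₂) ≠ 0`) — NO condition on the other lines.  Proof: `InBaker.of_psector` (chart + engine) and the hereditary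
cover of every boundary section by the pulled-back walls — centre segment (`InBaker.sqrt_const_even` /
zero), conic wall (zero), lines through the centre (null vertical walls), other lines
(`InBaker.psection_line`).  [KontsevichZagier2001 §1.2 rules (1)–(3); BCR1998 §2.2; this node] -/
theorem InBaker.of_psector_walls (hκ : 0 < κ₀ ∧ 0 ≤ κ₁) (γ a c : ℚ) (ha : a ≠ 0) {n : ℕ}
    (ℓ : Fin n → Wall) (hℓ0 : ∀ i, (ℓ i).k0 = 0 → (ℓ i).k1 ≠ 0 ∨ (ℓ i).k2 ≠ 0)
    (σ : KZ.IntegralRep 2) (hσo : IsOpen σ.domain)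
    (hσT : σ.domain ⊆ {w | 0 < w 1 ∧ w 1 < w 0 ∧ (κ₀ : ℝ) * w 0 ^ 2 + κ₁ * w 1 ^ 2 < 1})
    (hD : ∀ w ∈ σ.domain, 0 < (a : ℝ) * (κ₀ * w 0 ^ 2 + κ₁ * w 1 ^ 2) + c)
    (hσi : ∀ w ∈ σ.domain, σ.integrand w = ellW κ₀ κ₁ γ a c w)
    {C : Set (Fin 2 → ℝ)} (hC : IsClosed C) (hσC : σ.domain ⊆ C)
    (hCsec : ∀ w ∈ C, 0 ≤ w 1 ∧ w 1 ≤ w 0 ∧ (κ₀ : ℝ) * w 0 ^ 2 + κ₁ * w 1 ^ 2 ≤ 1)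
    (hwall : ∀ w ∈ C, w ∉ σ.domain → 0 < w 0 →
      (a : ℝ) * (κ₀ * w 0 ^ 2 + κ₁ * w 1 ^ 2) + c = 0 ∨ ∃ i, (ℓ i).eval (w 0) (w 1) = 0) :
    InBaker (KZ.of σ) := by
  classical
  have hκ0 : (0 : ℝ) < κ₀ := by exact_mod_cast hκ.1
  have hκ1 : (0 : ℝ) ≤ κ₁ := by exact_mod_cast hκ.2
  have ha' : (a : ℝ) ≠ 0 := by exact_mod_cast ha
  refine InBaker.of_psector hκ γ a c ha σ hσo hσT hD (fun w hw => by rw [hσi w hw, ellW])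
    fun S ζ hS hζ _ hfr r₁ hr₁ hr₁i => ?_
  -- what a section point looks like
  have hF : ∀ x ∈ S, 0 ≤ ζ x ∧ (0 < ζ x → (0 ≤ x 0 ∧ x 0 ≤ 1) ∧ ζ x ^ 2 ≤ 1 ∧
      ((a : ℝ) * ζ x ^ 2 + c = 0 ∨
        ∃ i, ζ x * ((ℓ i).k1 + (ℓ i).k2 * x 0) = -(ℓ i).k0 * pN κ₀ κ₁ (x 0))) := fun x hx => by
    obtain ⟨h0, h⟩ := psector_frontier_facts hκ hσo hC hσC hCsec (hfr x hx)
    refine ⟨h0, fun hz => ?_⟩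
    obtain ⟨ht, hz1, w, hwC, hwT, hX, hY, hsq, hXN⟩ := h hz
    refine ⟨ht, hz1, ?_⟩
    rcases hwall w hwC hwT hX with hDw | ⟨i, hi⟩
    · left
      rw [← hsq]
      linarith
    · right
      refine ⟨i, ?_⟩
      rw [Wall.eval, hY] at hi
      rw [← hXN]
      have hN := pN_pos hκ (x 0)
      linear_combination (pN κ₀ κ₁ (x 0)) * hi
  -- the cover of `S` by the pulled-back walls
  have hz0 : IsSemialgebraicFunOn ℚ S fun _ => (0 : ℝ) :=
    (isSemialgebraicFunOn_ratCast hS 0).congr fun _ _ => by simp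
  have hN : IsSemialgebraicFunOn ℚ S fun x => pN κ₀ κ₁ (x 0) :=
    (IsSemialgebraicFunOn.sqrt_holds (isSemialgebraicFunOn_aeval hS
      (MvPolynomial.C κ₀ + MvPolynomial.C κ₁ * X 0 ^ 2 : MvPolynomial (Fin 1) ℚ))).congr
      fun x _ => by simp [pN, pW]
  have hPc : IsSemialgebraic ℚ {x | x ∈ S ∧ ζ x = 0} :=
    isSemialgebraic_sep_eq hζ hz0
  have hPq : IsSemialgebraic ℚ {x | x ∈ S ∧ (a : ℝ) * ζ x ^ 2 + c = 0} :=
    isSemialgebraic_sep_eq ((((isSemialgebraicFunOn_ratCast hS a).mul_holds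
      (hζ.mul_holds hζ)).add_holds (isSemialgebraicFunOn_ratCast hS c)).congr fun x _ => by
        simp only [Pi.add_apply, Pi.mul_apply]; ring) hz0
  have hPl : ∀ i, IsSemialgebraic ℚ ({x | x ∈ S ∧
      ζ x * ((ℓ i).k1 + (ℓ i).k2 * x 0) = -(ℓ i).k0 * pN κ₀ κ₁ (x 0)} \ {x | x ∈ S ∧ ζ x = 0}) :=
    fun i => (isSemialgebraic_sep_eq
      ((hζ.mul_holds (isSemialgebraicFunOn_aeval hS
        (MvPolynomial.C (ℓ i).k1 + MvPolynomial.C (ℓ i).k2 * X 0 :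
          MvPolynomial (Fin 1) ℚ))).congr fun x _ => by
          simp only [Pi.mul_apply, map_add, map_mul, MvPolynomial.aeval_C, MvPolynomial.aeval_X,
            eq_ratCast])
      (((isSemialgebraicFunOn_ratCast hS (-(ℓ i).k0)).mul_holds hN).congr fun x _ => by
          simp only [Pi.mul_apply]; push_cast; ring)).diff hPc
  have hSr : r₁.domain ⊆ S := hr₁.le
  refine InBaker.of_cover' r₁
    (fun o : Option (Option (Fin n)) => match o with
      | none => {x | x ∈ S ∧ ζ x = 0}
      | some none => {x | x ∈ S ∧ (a : ℝ) * ζ x ^ 2 + c = 0}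
      | some (some i) => {x | x ∈ S ∧
          ζ x * ((ℓ i).k1 + (ℓ i).k2 * x 0) = -(ℓ i).k0 * pN κ₀ κ₁ (x 0)} \ {x | x ∈ S ∧ ζ x = 0})
    (fun o => ?_) (fun x hx => ?_) fun o T hT hTr hTA => ?_
  · rcases o with _ | _ | i
    · exact hPc
    · exact hPq
    · exact hPl i
  · have hxS : x ∈ S := hSr hx
    obtain ⟨h0, h⟩ := hF x hxS
    rcases h0.eq_or_lt with hz | hz
    · exact mem_iUnion.2 ⟨none, hxS, hz.symm⟩
    · obtain ⟨-, -, hq | ⟨i, hi⟩⟩ := h hz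
      · exact mem_iUnion.2 ⟨some none, hxS, hq⟩
      · exact mem_iUnion.2 ⟨some (some i), ⟨hxS, hi⟩, fun h' => hz.ne' h'.2⟩
  · have hTS : T ⊆ S := fun v hv => hSr (hTr hv)
    rcases o with _ | _ | i
    · -- the centre segment `r = 0`: `P(t, 0) = (γ c√c/(3a))/W(t)`
      have hTz : ∀ v ∈ T, ζ v = 0 := fun v hv => (hTA hv).2
      have hc0 : (a : ℝ) * 0 ^ 2 + c = c := by ring
      by_cases hc : 0 < c
      · refine InBaker.sqrt_const_even c hc (Polynomial.C (γ * c / (3 * a)))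
          (Polynomial.C κ₀ + Polynomial.C κ₁ * Polynomial.X) _ (fun v _ => ?_) fun v hv => ?_
        · have h3 : (0 : ℝ) < κ₀ + κ₁ * v 0 ^ 2 := by nlinarith [mul_nonneg hκ1 (sq_nonneg (v 0))]
          simp only [map_mul, map_add, Polynomial.aeval_C, Polynomial.aeval_X, eq_ratCast]
          exact h3.ne'
        · have h3 : (0 : ℝ) < κ₀ + κ₁ * v 0 ^ 2 := by nlinarith [mul_nonneg hκ1 (sq_nonneg (v 0))]
          have hq : qD 0 0 c (v 0) = c := by simp [qD]
          rw [KZ.IntegralRep.integrand_restrict, hr₁i (hTS hv)]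
          beta_reduce
          rw [ppot, snoc2_zero', snoc2_one', hTz v hv, ph, hc0, hq]
          simp only [map_mul, map_add, Polynomial.aeval_C, Polynomial.aeval_X, eq_ratCast]
          push_cast
          field_simp
      · have hc' : (c : ℝ) ≤ 0 := by exact_mod_cast not_lt.1 hc
        refine InBaker.of_mem_relations (KZ.of_mem_relations_of_eqOn_zero _ fun v hv => ?_)
        rw [KZ.IntegralRep.integrand_restrict, hr₁i (hTS hv)]
        beta_reduce
        rw [ppot, snoc2_zero', snoc2_one', hTz v hv, ph, hc0, Real.sqrt_eq_zero'.2 hc']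
        simp
    · -- the conic wall: the primitive vanishes
      refine InBaker.of_mem_relations (KZ.of_mem_relations_of_eqOn_zero _ fun v hv => ?_)
      have hq : (a : ℝ) * ζ v ^ 2 + c = 0 := (hTA hv).2
      rw [KZ.IntegralRep.integrand_restrict, hr₁i (hTS hv)]
      beta_reduce
      rw [ppot, snoc2_zero', snoc2_one', ph, hq]
      simp
    · -- a line wall
      have hTl : ∀ v ∈ T, v ∈ S ∧ 0 < ζ v ∧
          ζ v * ((ℓ i).k1 + (ℓ i).k2 * v 0) = -(ℓ i).k0 * pN κ₀ κ₁ (v 0) := fun v hv => by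
        obtain ⟨⟨hvS, hw⟩, hnz⟩ := hTA hv
        have hz : 0 < ζ v := ((hF v hvS).1).lt_of_ne fun h => hnz ⟨hvS, h.symm⟩
        exact ⟨hvS, hz, hw⟩
      by_cases hk : (ℓ i).k0 = 0
      · -- through the centre: the vertical wall `k₁ + k₂t = 0` (null)
        have hne : ∃ x : Fin 1 → ℝ, aeval x (MvPolynomial.C (ℓ i).k1 +
            MvPolynomial.C (ℓ i).k2 * X 0 : MvPolynomial (Fin 1) ℚ) ≠ 0 := by
          rcases hℓ0 i hk with h1 | h2
          · refine ⟨fun _ => 0, ?_⟩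
            simp only [map_add, map_mul, MvPolynomial.aeval_C, MvPolynomial.aeval_X, eq_ratCast,
              mul_zero, add_zero]
            exact_mod_cast h1
          · refine ⟨fun _ => ((1 - (ℓ i).k1) / (ℓ i).k2 : ℚ), ?_⟩
            simp only [map_add, map_mul, MvPolynomial.aeval_C, MvPolynomial.aeval_X, eq_ratCast]
            have h2' : ((ℓ i).k2 : ℝ) ≠ 0 := by exact_mod_cast h2
            rw [show ((ℓ i).k1 : ℝ) + (ℓ i).k2 * (((1 - (ℓ i).k1) / (ℓ i).k2 : ℚ) : ℝ) = 1 by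
              push_cast; field_simp; ring]
            exact one_ne_zero
        refine InBaker.of_subset_zeroSet _
          (MvPolynomial.C (ℓ i).k1 + MvPolynomial.C (ℓ i).k2 * X 0 : MvPolynomial (Fin 1) ℚ)
          hne fun v hv => ?_
        obtain ⟨-, hz, hw⟩ := hTl v hv
        rw [hk] at hw
        push_cast at hw
        simp only [neg_zero, zero_mul, mul_eq_zero] at hw
        rcases hw with h | h
        · exact absurd h hz.ne'
        · simp only [map_add, map_mul, MvPolynomial.aeval_C, MvPolynomial.aeval_X, eq_ratCast]
          exact h
      · -- a line off the centre: the Euler terminal and its degenerate strata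
        exact InBaker.psection_line hκ γ a c ha (ℓ i).k0 (ℓ i).k1 (ℓ i).k2 hk (S := T) ζ
          (fun v hv => ((hF v (hTl v hv).1).2 (hTl v hv).2.1).1)
          (fun v hv => ⟨(hTl v hv).2.1, ((hF v (hTl v hv).1).2 (hTl v hv).2.1).2.1⟩)
          (fun v hv => (hTl v hv).2.2) _ subset_rfl fun v hv => by
            rw [KZ.IntegralRep.integrand_restrict, hr₁i (hTS hv)]

/-! #### 34.6 Check: the specimen's sector from the instrument -/

/-- The three line walls of the specimen's sector `A`: `y = 0`, `x − y = 0`, `x = 1`. [this node] -/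
def specWalls : Fin 3 → Wall := ![⟨0, 0, 1⟩, ⟨0, 1, -1⟩, ⟨-1, 1, 0⟩]

/-- **THE SPECIMEN'S SECTOR AGAIN, from `InBaker.of_psector_walls`** (C = the closed hull `specC`; walls:
two lines through the centre and the line `x = 1`). [this node] -/
private theorem inBaker_specA' (γ : ℚ) (σ : KZ.IntegralRep 2) (hσ : σ.domain = specA)
    (hσi : ∀ w ∈ σ.domain, σ.integrand w = ellW (1 / 2) (1 / 2) γ 6 (-1) w) :
    InBaker (KZ.of σ) := by
  refine InBaker.of_psector_walls hκ_half γ 6 (-1) (by norm_num) specWalls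
    (fun i hi => ?_) σ (by rw [hσ]; exact isOpen_specA) (fun w hw => ?_) (fun w hw => ?_) hσi
    isClosed_specC (hσ ▸ specA_subset_specC) (fun w hw => ?_) fun w hwC hwA hw0 => ?_
  · fin_cases i <;> simp [specWalls] at hi ⊢
  · rw [hσ] at hw
    obtain ⟨⟨h1, h10, h01⟩, -⟩ := hw
    refine ⟨h1, h10, ?_⟩
    have hw0 : 0 < w 0 := h1.trans h10
    push_cast
    nlinarith [mul_pos hw0 (sub_pos.2 h01), mul_pos h1 (sub_pos.2 (h10.trans h01))]
  · rw [hσ] at hw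
    obtain ⟨-, hq⟩ := hw
    push_cast
    linarith
  · obtain ⟨⟨h1, h10, h01⟩, -⟩ := hw
    refine ⟨h1, h10, ?_⟩
    push_cast
    nlinarith [mul_nonneg h1 (sub_nonneg.2 h01), mul_nonneg (h1.trans h10) (sub_nonneg.2 h01)]
  · rw [hσ] at hwA
    obtain ⟨⟨h1, h10, h01⟩, hq⟩ := hwC
    rcases h1.eq_or_lt with h | h1'
    · exact Or.inr ⟨0, by simp [specWalls, Wall.eval, ← h]⟩
    rcases h10.eq_or_lt with h | h10'
    · exact Or.inr ⟨1, by simp [specWalls, Wall.eval, h]⟩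
    rcases h01.eq_or_lt with h | h01'
    · exact Or.inr ⟨2, by simp [specWalls, Wall.eval, h]⟩
    rcases hq.eq_or_lt with h | hq'
    · left
      push_cast
      linarith
    · exact absurd ⟨⟨h1', h10', h01'⟩, hq'⟩ hwA

end Summit.KontsevichZagierPeriods.RootDecompWalshStrata.ConicDescent.BallCube
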